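import Summits.QuantumFields.YangMills.Theorems.LuscherReductionDressedRitzPolyakovLiftStaticsOfSeparation
import HarnessLib

/-!
# Line «polyakovlift» on crux `DressedRitz` (stmt-QuantumFields-20205), stub S-STAT — CONSTRUCTORS for the one-site separation certificate `PairSeparated`:
# parities (Θ'₁, axis reflections, intrinsic parity, transpositions), `S₃`-invariant vs zero-average, `S₃`-sign type

Fleet-service module of seat ym-infvol-p1 g6 (route `LuscherReduction`, femto rung R2b1).  `…PolyakovLiftStaticsOfSeparation.lean` (this seat) proves
`OneSiteSeparatedAt k → (level-k S-STAT, C = 0)` from the certificate `PairSeparated (g i) (g l)`.  This file supplies the ready-made constructors a ONE-type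
prover (or the disprover) uses to certify a concrete pair of one-site channels, each a one-liner over the hyperoctahedral symmetries already shown to be
lift symmetries:

* `pairSeparated_of_involution` (generic; `_symm` variant with the roles of even∕odd exchanged);
* `pairSeparated_of_parity` (`Θ'₁`), `pairSeparated_of_axisParity k` (`R_k`), `pairSeparated_of_linkParity` (`P : V ↦ V⁻¹`), `pairSeparated_of_transposition μ ν`;
* `pairSeparated_of_S3_invariant` (f invariant under all axis permutations, h of zero `S₃`-average — seat g5's separation, now a certificate),
  `pairSeparated_of_S3_sign` (f of sign type, h with vanishing sign-twirl).

HONEST FRAMING: certificate bookkeeping on the conditional femto rung R2b1; no renormalisation-group content; nothing here bears on infinite volume, the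
continuum limit or the Clay gap.  References: M. Lüscher, NPB 219 (1983) 233, §2 [cite: Luscher1983, §2]; M. Lüscher, G. Münster, NPB 232 (1984) 445
[cite: LuscherMunster1984, §4].
-/

set_option autoImplicit false

noncomputable section

open MeasureTheory Filter Topology
open Literature.MathematicalPhysics.QuantumFieldTheory
open scoped BigOperators

namespace Summit.QuantumFields.YangMills.Theorems.FemtoTransferGap.PolyakovLift

open Summit.QuantumFields.YangMills.Theorems.FemtoTransferGap

/-! ## §1 Generic constructors -/

/-- An involutive lift symmetry with `f` even and `h` odd certifies the pair. [cite: Luscher1983, §2] -/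
theorem pairSeparated_of_involution {σ : GaugeConfig 3 1 SU2 → GaugeConfig 3 1 SU2} (hσ : IsLiftSymmetry σ) (hinv : ∀ V, σ (σ V) = V)
    {f h : GaugeConfig 3 1 SU2 → ℝ} (heven : ∀ V, f (σ V) = f V) (hodd : ∀ V, h (σ V) = -h V) : PairSeparated f h :=
  Or.inl ⟨σ, hσ, hinv, Or.inl ⟨heven, hodd⟩⟩

/-- The certificate by an involution is symmetric in the two channels. [folklore] -/
theorem pairSeparated_of_involution_symm {σ : GaugeConfig 3 1 SU2 → GaugeConfig 3 1 SU2} (hσ : IsLiftSymmetry σ) (hinv : ∀ V, σ (σ V) = V)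
    {f h : GaugeConfig 3 1 SU2 → ℝ} (hodd : ∀ V, f (σ V) = -f V) (heven : ∀ V, h (σ V) = h V) : PairSeparated f h :=
  Or.inl ⟨σ, hσ, hinv, Or.inr ⟨heven, hodd⟩⟩

/-! ## §2 Parities -/

/-- `Θ'₁`-parity: `f` even, `h` odd under inversion of the link along axis `0`. [cite: Luscher1983, §2] -/
theorem pairSeparated_of_parity {f h : GaugeConfig 3 1 SU2 → ℝ} (heven : ∀ V, f V.negReflect = f V) (hodd : ∀ V, h V.negReflect = -h V) :
    PairSeparated f h :=
  pairSeparated_of_involution isLiftSymmetry_negReflect WilsonSiteRP.negReflect_negReflect_config heven hodd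

/-- The axis reflection `R_k` is an involution on the one-point torus. [folklore] -/
theorem axisReflect_one_site_involutive (k : Fin 3) (V : GaugeConfig 3 1 SU2) :
    configPerm (Equiv.swap 0 k) ((configPerm (Equiv.swap 0 k)
      (configPerm (Equiv.swap 0 k) ((configPerm (Equiv.swap 0 k) V).negReflect))).negReflect) = V := by
  funext e
  obtain ⟨x, μ⟩ := e
  rw [axisReflect_one_site_apply, axisReflect_one_site_apply]
  by_cases hμ : μ = k
  · rw [if_pos hμ, if_pos hμ, inv_inv]
  · rw [if_neg hμ, if_neg hμ]

/-- `R_k`-parity: `f` even, `h` odd under inversion of the link along axis `k`. [cite: Luscher1983, §2] -/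
theorem pairSeparated_of_axisParity (k : Fin 3) {f h : GaugeConfig 3 1 SU2 → ℝ}
    (heven : ∀ V, f (configPerm (Equiv.swap 0 k) ((configPerm (Equiv.swap 0 k) V).negReflect)) = f V)
    (hodd : ∀ V, h (configPerm (Equiv.swap 0 k) ((configPerm (Equiv.swap 0 k) V).negReflect)) = -h V) : PairSeparated f h :=
  pairSeparated_of_involution (isLiftSymmetry_axisReflect k) (axisReflect_one_site_involutive k) heven hodd

/-- Intrinsic parity: `f` even, `h` odd under the total link inversion `V ↦ V⁻¹` (e.g. an `A₁⁺` channel against an `A₁⁻` channel). [cite: LuscherMunster1984, §4] -/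
theorem pairSeparated_of_linkParity {f h : GaugeConfig 3 1 SU2 → ℝ}
    (heven : ∀ V : GaugeConfig 3 1 SU2, f (fun e => (V e)⁻¹) = f V) (hodd : ∀ V : GaugeConfig 3 1 SU2, h (fun e => (V e)⁻¹) = -h V) :
    PairSeparated f h :=
  pairSeparated_of_involution isLiftSymmetry_linkInv (fun V => by funext e; simp only [inv_inv]) heven hodd

/-- An axis transposition is an involution on the one-point torus. [folklore] -/
theorem transposition_one_site_involutive (μ ν : Fin 3) (V : GaugeConfig 3 1 SU2) :
    configPerm (Equiv.swap μ ν) (configPerm (Equiv.swap μ ν) V) = V := by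
  funext e
  simp only [configPerm_apply, Equiv.symm_swap, Equiv.swap_apply_self]
  congr 1
  exact Prod.ext (funext fun j => by simp only [sitePerm_apply, Equiv.symm_swap, Equiv.swap_apply_self]) rfl

/-- Transposition parity: `f` even, `h` odd under the axis transposition `(μ ν)`. [cite: Luscher1983, §2] -/
theorem pairSeparated_of_transposition (μ ν : Fin 3) {f h : GaugeConfig 3 1 SU2 → ℝ}
    (heven : ∀ V, f (configPerm (Equiv.swap μ ν) V) = f V) (hodd : ∀ V, h (configPerm (Equiv.swap μ ν) V) = -h V) : PairSeparated f h :=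
  pairSeparated_of_involution (isLiftSymmetry_configPerm (Equiv.swap μ ν)) (transposition_one_site_involutive μ ν) heven hodd

/-! ## §3 `S₃` twirls (seat g5's separations as certificates) -/

/-- `P_π ∘ P_{π⁻¹} = id` on the one-point torus. [folklore] -/
theorem configPerm_configPerm_inv_one_site (π : Equiv.Perm (Fin 3)) (V : GaugeConfig 3 1 SU2) :
    configPerm π (configPerm π⁻¹ V) = V := by
  funext e
  obtain ⟨x, μ⟩ := e
  have hx : ∀ y : Site 3 1, y = x := fun y => Subsingleton.elim y x
  simp only [configPerm_apply, hx (sitePerm _ _)]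
  congr 1
  rw [Equiv.Perm.inv_def, Equiv.symm_symm, Equiv.apply_symm_apply]

/-- **`S₃`-invariant vs. zero `S₃`-average** ⟹ separated (twirl over all axis permutations, weight `1/6`, inverse pairing `π ↦ π⁻¹`). [cite: Luscher1983, §2] -/
theorem pairSeparated_of_S3_invariant {f h : GaugeConfig 3 1 SU2 → ℝ}
    (hfinv : ∀ (π : Equiv.Perm (Fin 3)) (V : GaugeConfig 3 1 SU2), f (configPerm π V) = f V)
    (hhavg : ∀ V : GaugeConfig 3 1 SU2, ∑ π : Equiv.Perm (Fin 3), h (configPerm π V) = 0) : PairSeparated f h := by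
  refine Or.inr (Or.inl ⟨Equiv.Perm (Fin 3), inferInstance, fun π V => configPerm π V, Equiv.inv (Equiv.Perm (Fin 3)),
    fun _ => (1 / 6 : ℝ), fun π => isLiftSymmetry_configPerm π, fun π V => ?_, fun _ => rfl, Or.inl ⟨fun V => ?_, fun V => ?_⟩⟩)
  · exact configPerm_configPerm_inv_one_site π V
  · simp only [hfinv, Finset.sum_const, Finset.card_univ, Fintype.card_perm, Fintype.card_fin, nsmul_eq_mul]
    norm_num; ring
  · rw [← Finset.mul_sum, hhavg, mul_zero]

/-- **`S₃`-sign type vs. vanishing sign-twirl** ⟹ separated (weight `sign π / 6`; `sign π⁻¹ = sign π`). [cite: Luscher1983, §2] -/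
theorem pairSeparated_of_S3_sign {f h : GaugeConfig 3 1 SU2 → ℝ}
    (hfsgn : ∀ (π : Equiv.Perm (Fin 3)) (V : GaugeConfig 3 1 SU2), f (configPerm π V) = ((Equiv.Perm.sign π : ℤ) : ℝ) * f V)
    (hhavg : ∀ V : GaugeConfig 3 1 SU2, ∑ π : Equiv.Perm (Fin 3), ((Equiv.Perm.sign π : ℤ) : ℝ) * h (configPerm π V) = 0) :
    PairSeparated f h := by
  have hsq : ∀ π : Equiv.Perm (Fin 3), ((Equiv.Perm.sign π : ℤ) : ℝ) * ((Equiv.Perm.sign π : ℤ) : ℝ) = 1 := fun π => by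
    rcases Int.units_eq_one_or (Equiv.Perm.sign π) with h1 | h1 <;> simp [h1]
  refine Or.inr (Or.inl ⟨Equiv.Perm (Fin 3), inferInstance, fun π V => configPerm π V, Equiv.inv (Equiv.Perm (Fin 3)),
    fun π => ((Equiv.Perm.sign π : ℤ) : ℝ) / 6, fun π => isLiftSymmetry_configPerm π, fun π V => ?_, fun π => ?_, Or.inl ⟨fun V => ?_, fun V => ?_⟩⟩)
  · exact configPerm_configPerm_inv_one_site π V
  · simp only [Equiv.inv_apply, Equiv.Perm.sign_inv]
  · have hterm : ∀ π : Equiv.Perm (Fin 3), ((Equiv.Perm.sign π : ℤ) : ℝ) / 6 * f (configPerm π V) = (1 / 6 : ℝ) * f V := fun π => by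
      rw [hfsgn, div_mul_eq_mul_div, ← mul_assoc, hsq]; ring
    simp only [hterm, Finset.sum_const, Finset.card_univ, Fintype.card_perm, Fintype.card_fin, nsmul_eq_mul]
    norm_num; ring
  · have hterm : ∀ π : Equiv.Perm (Fin 3), ((Equiv.Perm.sign π : ℤ) : ℝ) / 6 * h (configPerm π V) =
        (1 / 6 : ℝ) * (((Equiv.Perm.sign π : ℤ) : ℝ) * h (configPerm π V)) := fun π => by ring
    simp only [hterm, ← Finset.mul_sum, hhavg, mul_zero]

end Summit.QuantumFields.YangMills.Theorems.FemtoTransferGap.PolyakovLift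

end
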